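import Summits.QuantumFields.BalabanUV.Beta.GAN24.DerivativeRateTransferSqueeze
import Summits.QuantumFields.BalabanUV.Beta.GAN24.DerivativeRateTransferLoewnerGramEnd
import Summits.QuantumFields.BalabanUV.Beta.GAN24.DerivativeRateTransferJensenIntertwine

/-!
# `BalabanUV.Beta.GAN24.DerivativeRateTransferSqueezeEnd` — binder row G-an2-4 ∕ (CONV-C), route R6 «VALUES, NOT DERIVATIVES», PART 32:
# THE CAPSTONE OF THE ROW-DEFECT SQUEEZE — an1's `dEffForm` rows along a real affine two-bond tower ⇐ (STAB-ε′,δ′) + (PROL-ε,δ) + (ROW) + the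
# k-uniform form bound `Λ` and Gram bound `N` + S2, with NO averaging-compatibility of the prolongation and NO (CONS); and the junction
# «(PROL-ε,δ) IS PART 28's intertwining Jensen read with `(X, Y, Q) := (level j, level j+1, P)`» (unit b2b-balaban-gan24-p3, gen 38; v1.3 (= v1.2 + the two `import` lines the concat certificate supplied; body byte-identical) = v1 + §3 the legs)

NOT IN PRINT; OUR PROOF (for the ROUTE; [folklore] — PART 29 `effForm_entry_step_rate_of_stabGram_of_prolGram_of_row` + PART 19's realification letters
(`effForm_affine₂_ofReal`, `isUnit_det_kkt_affine₂_real`) + PART 13 `dEffForm_step_rateω` + PART 23 `stabGram_of_family` BY NAME).  HONEST FRAMING (cell contract,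
verbatim): «discharging `BetaPertH` makes Bałaban's UV stability UNCONDITIONAL — a real constructive-QFT result; it is NOT the continuum limit and NOT the Clay
problem.»  HONEST DEPENDENCY (verbatim): «continuum YM on T⁴ ⇐ BetaPertH ∧ nine spine estimates (0/9 proved); BetaPertH ⇐ (D1) ∧ (D4) ∧ CAP+tail; G-an2-4
gates asym, D1 and NE2/3/4.»

WHY THIS FILE.  PART 23 is the capstone under (STAB-ε,δ) + (CONS); PART 29 replaced (CONS) by (PROL-ε,δ) + (ROW) + `Λ`.  §1 records that (PROL-ε,δ) needs no new
supplier: PART 28's `posSemidef_intertwine_jensen` is symmetric in the two levels — read with the PROLONGATION as the map and the intertwining identity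
`D′(Pu) = Σ q·W·(Du) + Eu` of its fine differences (at `U = 1` for the multilinear prolongation: gan24-p2's `MultilinearProlongation.Pml_step`, `E = 0`; with a
background: holonomy defects), it IS `((1+t)•H_j + ((1+t⁻¹)·w_{j+1}·K)•1 − PᵀH_{j+1}P).PosSemidef`, and PART 23's `stabGram_of_family` makes the `t = θ^j` choice
for it verbatim.  §2 is PART 23 §2 with the new hypothesis set: the real entry rate `((1 + cε + 2cε′ + cϱ)·Λ + (cδ + 2cδ′)·N)·θ^k` from PART 29, realified along
the affine two-bond family, fed to PART 13 — an1's first B-jet rows from (STAB-ε′,δ′) + (PROL-ε,δ) + (ROW) + `Λ` + `N` + S2, every slack in the constant.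

WHAT THIS FILE PROVES (0 sorry, 0 `def`, nothing cited):
* §1 **`prolGram_of_intertwine`** (PART 28 in (PROL) orientation: `((1+t)•H + ((1+t⁻¹)·w′·K)•1 − PᵀH′P).PosSemidef` from an intertwining identity for `P`),
  **`prolGram_of_family`** (the `t = τ` choice, PART 23's `stabGram_of_family` verbatim: `0 ≤ K ≤ cK·τ²`, `0 < τ ≤ 1` ⟹ `((1+τ)•H + (2cK·τ)•G − PᵀH′P).PosSemidef`).
* §3 `dotProduct_mulVec_add_le` (PSD parallelogram bound), **`leg_energy_le_of_stabGram_of_prolGram_of_row`** — the debt line's «S1-legs» under the new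
  hypotheses: `⟨Pℋe_y − ℋ′e_y, H′(Pℋe_y − ℋ′e_y)⟩ ≤ 2·(((1+ε)(1+ε′) − (1−t))·Λ + ((1+ε)δ′ + δ)·N + t⁻¹Λϱ) + 2·Λϱ` (formerly ⇐ (CONS), PART 18 ∕ 20),
  and the tower form **`leg_energy_step_rate_of_stabGram_of_prolGram_of_row`** (`≤ C_leg·θ^j`, `t = θ^j`, `0 < θ ≤ 1`).
* §4 **`effForm_affine₂_step_rate_of_stabGram_of_prolGram_of_row`** (the complexified value rate on the real square `[0,s₁]²` with constant
  `C = (1 + cε + 2cε′ + cϱ)·Λ + (cδ + 2cδ′)·N`), **`dEffForm_step_rateω_of_stabGram_of_prolGram_of_row`**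
  (`‖dEffForm_{k+1} − dEffForm_k‖ ≤ 25·(2B)^r∕(s₁r²)·C^{1−r}·(θ^{1−r})^k`, every `r ∈ ]0,1]`).
WHAT IT DOES NOT DO: produce the tower data, the intertwining identity, `κ_j`, `Λ`, `N`, S2 or S2(ii) for any of Bałaban's operators.  SUPPLIER work on route R6
(rank 2, REDUCTION, no seat); no consumer of record; NEVER «G-an2-4 closed»; NOT (CONV-C), NOT D1, NOT `BetaPertH`, NOT continuum, NOT Clay.
Records: `HOME/b2b-balaban-gan24-p3/WOODBURY-FIBRE.md` v13.8.
-/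

noncomputable section

open Set Metric Matrix

namespace Summit.QuantumFields.BalabanUV.Beta.GAN24.DerivativeRateTransferSqueezeEnd

open Literature.MathematicalPhysics.QuantumFieldTheory.Balaban1983to89.Beta.Composition (kkt)
open Literature.MathematicalPhysics.QuantumFieldTheory.Balaban1983to89.Beta.CompositionSingular (effForm minOp)
open Literature.MathematicalPhysics.QuantumFieldTheory.Balaban1983to89.Beta.BorderedJets (dEffForm)
open Summit.QuantumFields.BalabanUV.Beta.GAN24.DerivativeRateTransferAnalyticKKTEnd (dEffForm_step_rateω)
open Summit.QuantumFields.BalabanUV.Beta.GAN24.DerivativeRateTransferLoewnerKKT (transpose_eq_of_posSemidef mulVec_dotProduct_eq dotProduct_effForm_eq_energy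
  mulVec_minOp single_dotProduct_mulVec_single energy_split)
open Summit.QuantumFields.BalabanUV.Beta.GAN24.DerivativeRateTransferLoewnerGram (gram_minOp_apply effForm_step_posSemidef_of_stabGram)
open Summit.QuantumFields.BalabanUV.Beta.GAN24.DerivativeRateTransferSqueeze (effForm_entry_step_rate_of_stabGram_of_prolGram_of_row
  dotProduct_mulVec_minOp_eq neg_two_cross_le dotProduct_effForm_nonneg abs_effForm_apply_le_of_form_le)
open Summit.QuantumFields.BalabanUV.Beta.GAN24.DerivativeRateTransferLoewnerEnd (effForm_affine₂_ofReal isUnit_det_kkt_affine₂_real)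
open Summit.QuantumFields.BalabanUV.Beta.GAN24.DerivativeRateTransferLoewnerGramEnd (stabGram_of_family)
open Summit.QuantumFields.BalabanUV.Beta.GAN24.DerivativeRateTransferJensenIntertwine (posSemidef_intertwine_jensen)

/-! ## §1 (PROL-ε,δ) is PART 28's intertwining Jensen, read with the prolongation as the map -/

section Prol

variable {o B B' X Y : Type*} [Fintype o] [DecidableEq o] [Fintype B] [Fintype B'] [Fintype X] [Fintype Y] [DecidableEq X]
variable {q : B' → B → ℝ} {W : B' → B → Matrix o o ℝ} {m w w' K : ℝ}
variable {D : (X → ℝ) → B → o → ℝ} {D' : (Y → ℝ) → B' → o → ℝ} {Eu : (X → ℝ) → B' → o → ℝ}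
variable {P : Matrix Y X ℝ} {H : Matrix X X ℝ} {H' : Matrix Y Y ℝ}

/-- **`prolGram_of_intertwine` — (PROL-ε,δ) FROM AN INTERTWINING IDENTITY FOR THE PROLONGATION** [our proof = PART 28 `posSemidef_intertwine_jensen` with
`(X, Y, Q) := (level j, level j+1, P)`]: coarse bond differences `Du b`, fine ones `D′v b′`; the prolongation's fine differences are transported sub-stochastic
means of coarse ones plus a defect, `D′(Pu) b′ = Σ_b q(b′,b)·W(b′,b)(Du b) + Eu b′` (column sums `≤ m`, orthogonal `W`); the coarse form bounds its bond energy
from above in the sense `w·Σ_b|Du b|² ≤ ⟨u,Hu⟩`, the fine form is bounded by its bond energy `⟨v,H′v⟩ ≤ w′·Σ_{b′}|D′v b′|²`, `w′·m ≤ w`, defect mass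
`Σ_{b′}|Eu b′|² ≤ K|u|²` ⟹ for every `t > 0`: `((1 + t)•H + ((1 + t⁻¹)·w′·K)•1 − PᵀH′P).PosSemidef`.  At `U = 1` for the multilinear prolongation the identity
is gan24-p2's `Pml_step` with `E = 0` (`K = 0`). -/
theorem prolGram_of_intertwine (hq : ∀ b' b, 0 ≤ q b' b) (hq1 : ∀ b', ∑ b, q b' b ≤ 1) (hW : ∀ b' b, (W b' b)ᵀ * W b' b = 1)
    (hmult : ∀ b, ∑ b', q b' b ≤ m) (hw' : 0 ≤ w') (hw : w' * m ≤ w) (hHs : Hᵀ = H) (hH's : H'ᵀ = H')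
    (hH : ∀ u : X → ℝ, w * ∑ b, D u b ⬝ᵥ D u b ≤ u ⬝ᵥ (H *ᵥ u))
    (hH' : ∀ v : Y → ℝ, v ⬝ᵥ (H' *ᵥ v) ≤ w' * ∑ b', D' v b' ⬝ᵥ D' v b')
    (hint : ∀ (u : X → ℝ) b', D' (P *ᵥ u) b' = ∑ b, q b' b • (W b' b *ᵥ D u b) + Eu u b')
    (hE : ∀ u : X → ℝ, ∑ b', Eu u b' ⬝ᵥ Eu u b' ≤ K * (u ⬝ᵥ u)) {t : ℝ} (ht : 0 < t) :
    ((1 + t) • H + ((1 + t⁻¹) * w' * K) • (1 : Matrix X X ℝ) - Pᵀ * H' * P).PosSemidef :=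
  posSemidef_intertwine_jensen hq hq1 hW hmult hw' hw hHs hH's hH hH' hint hE ht

omit [Fintype X] [DecidableEq X] in
/-- **`prolGram_of_family` — THE `t = τ` CHOICE FOR (PROL)** [PART 23 `stabGram_of_family` verbatim]: the Peter–Paul family for every `t > 0` with a mass form
`G ≥ 0` and a defect `0 ≤ K ≤ cK·τ²` (`0 < τ ≤ 1`; at level `j`: `τ = θ^j`) ⟹ `((1 + τ)•H + (2cK·τ)•G − PᵀH′P).PosSemidef` — PART 29's (PROL-ε_j,δ_j). -/
theorem prolGram_of_family {G : Matrix X X ℝ} {cK τ : ℝ}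
    (hfam : ∀ t : ℝ, 0 < t → ((1 + t) • H + ((1 + t⁻¹) * K) • G - Pᵀ * H' * P).PosSemidef)
    (hG : G.PosSemidef) (hK0 : 0 ≤ K) (hK : K ≤ cK * τ ^ 2) (hτ : 0 < τ) (hτ1 : τ ≤ 1) :
    ((1 + τ) • H + (2 * cK * τ) • G - Pᵀ * H' * P).PosSemidef :=
  stabGram_of_family hfam hG hK0 hK hτ hτ1

end Prol


/-! ## §3 The minimiser LEGS in energy currency under (PROL-ε,δ) + (ROW) (the debt line's «S1-legs», formerly ⇐ (CONS)) -/

section Legs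

variable {c ν ν' : Type*} [Fintype c] [Fintype ν] [Fintype ν'] [DecidableEq c] [DecidableEq ν] [DecidableEq ν']
variable {H : Matrix ν ν ℝ} {Q : Matrix c ν ℝ} {H' : Matrix ν' ν' ℝ} {Q' : Matrix c ν' ℝ} {Qf : Matrix ν ν' ℝ} {P : Matrix ν' ν ℝ}
variable {G : Matrix ν ν ℝ} {G' : Matrix ν' ν' ℝ} {ε δ ε' δ' Λ : ℝ}

omit [Fintype c] [Fintype ν] [DecidableEq c] [DecidableEq ν] [DecidableEq ν'] in
/-- the PSD parallelogram bound: `⟨a + b, H′(a + b)⟩ ≤ 2⟨a, H′a⟩ + 2⟨b, H′b⟩`. [folklore] -/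
theorem dotProduct_mulVec_add_le (hH' : H'.PosSemidef) (a b : ν' → ℝ) :
    (a + b) ⬝ᵥ (H' *ᵥ (a + b)) ≤ 2 * (a ⬝ᵥ (H' *ᵥ a)) + 2 * (b ⬝ᵥ (H' *ᵥ b)) := by
  have hHt : H'ᵀ = H' := transpose_eq_of_posSemidef hH'
  have h0 := hH'.dotProduct_mulVec_nonneg (a - b)
  have hsym : b ⬝ᵥ (H' *ᵥ a) = a ⬝ᵥ (H' *ᵥ b) := by
    rw [dotProduct_mulVec, ← mulVec_transpose, hHt, dotProduct_comm]
  simp only [star_trivial, mulVec_sub, sub_dotProduct, dotProduct_sub, hsym] at h0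
  rw [mulVec_add, add_dotProduct, dotProduct_add, dotProduct_add, hsym]
  linarith

/-- **`leg_energy_le_of_stabGram_of_prolGram_of_row` — THE MINIMISER LEG IN ENERGY CURRENCY UNDER THE ROW-DEFECT SQUEEZE** [our proof]: `Q′ = Q·Qf`,
(STAB-ε′,δ′) `QfᵀHQf ≤ (1+ε′)H′ + δ′G′`, (PROL-ε,δ) `PᵀH′P ≤ (1+ε)H + δG`, the form bound `Λ` on the finer effective form, Gram bounds `N`, the row defect
`r_y := Q′Pℋe_y − e_y` with `⟨r_y,r_y⟩ ≤ ϱ`, `0 ≤ ε, δ, ε′, δ′`, `0 < t` ⟹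
`⟨Pℋe_y − ℋ′e_y, H′(Pℋe_y − ℋ′e_y)⟩ ≤ 2·(((1+ε)(1+ε′) − (1−t))·Λ + ((1+ε)δ′ + δ)·N + t⁻¹Λϱ) + 2·Λϱ`.  Proof: the admissible trial `f = Pℋe_y − ℋ′r_y`
satisfies `⟨f − ℋ′e_y, H′(f − ℋ′e_y)⟩ = ⟨f,H′f⟩ − 𝒮′_yy` (PART 18's `energy_split`), `⟨f,H′f⟩ = ⟨ℋe_y, PᵀH′Pℋe_y⟩ − 2⟨e_y,𝒮′r⟩ − ⟨r,𝒮′r⟩` (PART 29),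
and `Pℋe_y − ℋ′e_y = (f − ℋ′e_y) + ℋ′r_y` with `⟨ℋ′r, H′ℋ′r⟩ = ⟨r,𝒮′r⟩ ≤ Λϱ`. -/
theorem leg_energy_le_of_stabGram_of_prolGram_of_row (hH : H.PosSemidef) (hH' : H'.PosSemidef) (h : IsUnit (kkt H Q).det)
    (h' : IsUnit (kkt H' Q').det) (hcomp : Q' = Q * Qf) (hG' : G'ᵀ = G') {ϱ N : ℝ} {t : ℝ} (ht : 0 < t)
    (hε : 0 ≤ ε) (hδ : 0 ≤ δ) (hε' : 0 ≤ ε') (hδ' : 0 ≤ δ')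
    (hstab : ((1 + ε') • H' + δ' • G' - Qfᵀ * H * Qf).PosSemidef) (hprol : ((1 + ε) • H + δ • G - Pᵀ * H' * P).PosSemidef)
    (hΛ' : ∀ w : c → ℝ, w ⬝ᵥ (effForm H' Q' *ᵥ w) ≤ Λ * (w ⬝ᵥ w))
    (hN : ∀ a b, |((minOp H Q)ᵀ * G * minOp H Q) a b| ≤ N) (hN' : ∀ a b, |((minOp H' Q')ᵀ * G' * minOp H' Q') a b| ≤ N) (y : c)
    (hrow : (Q' *ᵥ (P *ᵥ (minOp H Q *ᵥ Pi.single y 1)) - Pi.single y 1) ⬝ᵥ (Q' *ᵥ (P *ᵥ (minOp H Q *ᵥ Pi.single y 1)) - Pi.single y 1) ≤ ϱ) :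
    (P *ᵥ (minOp H Q *ᵥ Pi.single y 1) - minOp H' Q' *ᵥ Pi.single y 1) ⬝ᵥ
        (H' *ᵥ (P *ᵥ (minOp H Q *ᵥ Pi.single y 1) - minOp H' Q' *ᵥ Pi.single y 1)) ≤
      2 * (((1 + ε) * (1 + ε') - (1 - t)) * Λ + ((1 + ε) * δ' + δ) * N + t⁻¹ * Λ * ϱ) + 2 * (Λ * ϱ) := by
  set v : c → ℝ := Pi.single y 1 with hv
  set m : ν → ℝ := minOp H Q *ᵥ v with hm
  set r : c → ℝ := Q' *ᵥ (P *ᵥ m) - v with hr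
  set g : ν' → ℝ := minOp H' Q' *ᵥ r with hg
  have hHt : H'ᵀ = H' := transpose_eq_of_posSemidef hH'
  have hadm : Q' *ᵥ (P *ᵥ m - g) = v := by rw [mulVec_sub, hg, mulVec_minOp h', hr, sub_sub_cancel]
  -- the trial energy, expanded as in PART 29
  have hPm : (P *ᵥ m) ⬝ᵥ (H' *ᵥ (P *ᵥ m)) = m ⬝ᵥ ((Pᵀ * H' * P) *ᵥ m) := by
    rw [mulVec_dotProduct_eq, mulVec_mulVec, mulVec_mulVec, Matrix.mul_assoc]
  have hcross : (P *ᵥ m) ⬝ᵥ (H' *ᵥ g) = v ⬝ᵥ (effForm H' Q' *ᵥ r) + r ⬝ᵥ (effForm H' Q' *ᵥ r) := by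
    rw [hg, dotProduct_mulVec_minOp_eq h', ← add_dotProduct]
    congr 1
    rw [hr, add_sub_cancel]
  have hcross' : g ⬝ᵥ (H' *ᵥ (P *ᵥ m)) = (P *ᵥ m) ⬝ᵥ (H' *ᵥ g) := by
    rw [dotProduct_mulVec, ← mulVec_transpose, hHt, dotProduct_comm]
  have hgg : g ⬝ᵥ (H' *ᵥ g) = r ⬝ᵥ (effForm H' Q' *ᵥ r) := by rw [hg, ← dotProduct_effForm_eq_energy h' r]
  have hexp : (P *ᵥ m - g) ⬝ᵥ (H' *ᵥ (P *ᵥ m - g)) =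
      m ⬝ᵥ ((Pᵀ * H' * P) *ᵥ m) - 2 * (v ⬝ᵥ (effForm H' Q' *ᵥ r)) - r ⬝ᵥ (effForm H' Q' *ᵥ r) := by
    rw [mulVec_sub, sub_dotProduct, dotProduct_sub, dotProduct_sub, hPm, hcross', hcross, hgg]
    ring
  -- the split of the trial energy at the finer minimiser
  have hsplit := energy_split hHt h' hadm
  -- letters
  have hpr := hprol.dotProduct_mulVec_nonneg m
  simp only [star_trivial, sub_mulVec, add_mulVec, smul_mulVec, dotProduct_sub, dotProduct_add, dotProduct_smul, smul_eq_mul,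
    sub_nonneg] at hpr
  have hcr := neg_two_cross_le hH' h' v r ht
  have hrr0 : 0 ≤ r ⬝ᵥ (effForm H' Q' *ᵥ r) := dotProduct_effForm_nonneg hH' h' r
  have hrr : r ⬝ᵥ (effForm H' Q' *ᵥ r) ≤ Λ * ϱ := by
    refine (hΛ' r).trans (mul_le_mul_of_nonneg_left hrow ?_)
    exact (abs_nonneg _).trans (abs_effForm_apply_le_of_form_le hH' h' hΛ' y y)
  have hmul : t⁻¹ * (r ⬝ᵥ (effForm H' Q' *ᵥ r)) ≤ t⁻¹ * (Λ * ϱ) := mul_le_mul_of_nonneg_left hrr (inv_pos.mpr ht).le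
  have e1 : v ⬝ᵥ (effForm H' Q' *ᵥ v) = effForm H' Q' y y := single_dotProduct_mulVec_single _ y
  have e2 : m ⬝ᵥ (H *ᵥ m) = effForm H Q y y := by rw [hm, ← dotProduct_effForm_eq_energy h v]; exact single_dotProduct_mulVec_single _ y
  have e3 : m ⬝ᵥ (G *ᵥ m) = ((minOp H Q)ᵀ * G * minOp H Q) y y := by rw [gram_minOp_apply, ← hv, ← hm]
  have hS'yy : effForm H' Q' y y ≤ Λ := (abs_le.mp (abs_effForm_apply_le_of_form_le hH' h' hΛ' y y)).2
  have hNyy : ((minOp H Q)ᵀ * G * minOp H Q) y y ≤ N := (abs_le.mp (hN y y)).2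
  have hN'yy : ((minOp H' Q')ᵀ * G' * minOp H' Q') y y ≤ N := (abs_le.mp (hN' y y)).2
  -- the (STAB) side on the diagonal: `𝒮_yy ≤ (1+ε′)𝒮′_yy + δ′N`
  have hD := (effForm_step_posSemidef_of_stabGram hH hH' h h' hcomp hG' hstab).diag_nonneg (i := y)
  rw [Matrix.sub_apply, Matrix.add_apply, Matrix.smul_apply, Matrix.smul_apply, smul_eq_mul, smul_eq_mul] at hD
  -- bound for the trial minus the finer minimiser
  have hA : (P *ᵥ m - g - minOp H' Q' *ᵥ v) ⬝ᵥ (H' *ᵥ (P *ᵥ m - g - minOp H' Q' *ᵥ v)) ≤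
      ((1 + ε) * (1 + ε') - (1 - t)) * Λ + ((1 + ε) * δ' + δ) * N + t⁻¹ * Λ * ϱ := by
    have hval : (P *ᵥ m - g - minOp H' Q' *ᵥ v) ⬝ᵥ (H' *ᵥ (P *ᵥ m - g - minOp H' Q' *ᵥ v)) =
        (P *ᵥ m - g) ⬝ᵥ (H' *ᵥ (P *ᵥ m - g)) - v ⬝ᵥ (effForm H' Q' *ᵥ v) := by linarith [hsplit]
    rw [hval, hexp, e1]
    rw [e2, e3] at hpr
    rw [e1] at hcr
    have hε1 : 0 ≤ 1 + ε := by linarith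
    have hS : effForm H Q y y ≤ (1 + ε') * effForm H' Q' y y + δ' * ((minOp H' Q')ᵀ * G' * minOp H' Q') y y := by linarith [hD]
    have h1 := mul_le_mul_of_nonneg_left hS hε1
    have hc : 0 ≤ (1 + ε) * (1 + ε') + t - 1 := by nlinarith [mul_nonneg hε hε']
    have h2 := mul_le_mul_of_nonneg_left hS'yy hc
    have h3 : (1 + ε) * δ' * ((minOp H' Q')ᵀ * G' * minOp H' Q') y y ≤ (1 + ε) * δ' * N :=
      mul_le_mul_of_nonneg_left hN'yy (mul_nonneg hε1 hδ')
    have h4 : δ * ((minOp H Q)ᵀ * G * minOp H Q) y y ≤ δ * N := mul_le_mul_of_nonneg_left hNyy hδ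
    linarith [hpr, hcr, hrr0, hmul, h1, h2, h3, h4]
  -- assemble with the parallelogram bound
  have hdecomp : P *ᵥ m - minOp H' Q' *ᵥ v = (P *ᵥ m - g - minOp H' Q' *ᵥ v) + g := by abel
  rw [hdecomp]
  refine (dotProduct_mulVec_add_le hH' _ _).trans ?_
  rw [hgg]
  linarith [hA, hrr]

/-- **`leg_energy_step_rate_of_stabGram_of_prolGram_of_row` — THE LEGS ALONG THE TOWER** [our proof]: PART 29's tower hypotheses ((STAB-ε′_j,δ′_j), (PROL-ε_j,δ_j),
(ROW_j) `≤ cϱ·(θ^j)²`, `Λ`, `N`) with `0 < θ ≤ 1` ⟹ for all `j, y`: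
`⟨P_jℋ_je_y − ℋ_{j+1}e_y, H_{j+1}(P_jℋ_je_y − ℋ_{j+1}e_y)⟩ ≤ (2·((1 + cε + cε′ + cε·cε′)·Λ + ((1 + cε)·cδ′ + cδ)·N + Λ·cϱ) + 2·Λ·cϱ)·θ^j` (`t = θ^j`). -/
theorem leg_energy_step_rate_of_stabGram_of_prolGram_of_row {ι : ℕ → Type*} [∀ j, Fintype (ι j)] [∀ j, DecidableEq (ι j)]
    {H : ∀ j, Matrix (ι j) (ι j) ℝ} {Qf : ∀ j, Matrix (ι j) (ι (j + 1)) ℝ} {Qc : ∀ j, Matrix c (ι j) ℝ}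
    {P : ∀ j, Matrix (ι (j + 1)) (ι j) ℝ} {G : ∀ j, Matrix (ι j) (ι j) ℝ} {cε cδ cε' cδ' cϱ θ Λ N : ℝ}
    (hH : ∀ j, (H j).PosSemidef) (hk : ∀ j, IsUnit (kkt (H j) (Qc j)).det)
    (hcomp : ∀ j, Qc (j + 1) = Qc j * Qf j) (hG : ∀ j, (G j)ᵀ = G j)
    (hcε : 0 ≤ cε) (hcδ : 0 ≤ cδ) (hcε' : 0 ≤ cε') (hcδ' : 0 ≤ cδ') (hcϱ : 0 ≤ cϱ) (hθ0 : 0 < θ) (hθ1 : θ ≤ 1) (hΛ0 : 0 ≤ Λ) (hN0 : 0 ≤ N)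
    (hstab : ∀ j, ((1 + cε' * θ ^ j) • H (j + 1) + (cδ' * θ ^ j) • G (j + 1) - (Qf j)ᵀ * H j * Qf j).PosSemidef)
    (hprol : ∀ j, ((1 + cε * θ ^ j) • H j + (cδ * θ ^ j) • G j - (P j)ᵀ * H (j + 1) * P j).PosSemidef)
    (hrow : ∀ j (y : c), (Qc (j + 1) *ᵥ (P j *ᵥ (minOp (H j) (Qc j) *ᵥ Pi.single y 1)) - Pi.single y 1) ⬝ᵥ
        (Qc (j + 1) *ᵥ (P j *ᵥ (minOp (H j) (Qc j) *ᵥ Pi.single y 1)) - Pi.single y 1) ≤ cϱ * (θ ^ j) ^ 2)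
    (hΛ : ∀ j (w : c → ℝ), w ⬝ᵥ (effForm (H j) (Qc j) *ᵥ w) ≤ Λ * (w ⬝ᵥ w))
    (hN : ∀ j a b, |((minOp (H j) (Qc j))ᵀ * G j * minOp (H j) (Qc j)) a b| ≤ N) (j : ℕ) (y : c) :
    (P j *ᵥ (minOp (H j) (Qc j) *ᵥ Pi.single y 1) - minOp (H (j + 1)) (Qc (j + 1)) *ᵥ Pi.single y 1) ⬝ᵥ
        (H (j + 1) *ᵥ (P j *ᵥ (minOp (H j) (Qc j) *ᵥ Pi.single y 1) - minOp (H (j + 1)) (Qc (j + 1)) *ᵥ Pi.single y 1)) ≤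
      (2 * ((1 + cε + cε' + cε * cε') * Λ + ((1 + cε) * cδ' + cδ) * N + Λ * cϱ) + 2 * (Λ * cϱ)) * θ ^ j := by
  have hθj : 0 < θ ^ j := pow_pos hθ0 j
  have hθj1 : θ ^ j ≤ 1 := pow_le_one₀ hθ0.le hθ1
  have h := leg_energy_le_of_stabGram_of_prolGram_of_row (hH j) (hH (j + 1)) (hk j) (hk (j + 1)) (hcomp j) (hG (j + 1)) hθj
    (mul_nonneg hcε hθj.le) (mul_nonneg hcδ hθj.le) (mul_nonneg hcε' hθj.le) (mul_nonneg hcδ' hθj.le) (hstab j) (hprol j) (hΛ (j + 1))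
    (fun a b => hN j a b) (fun a b => hN (j + 1) a b) y (hrow j y)
  refine h.trans ?_
  have hinv : (θ ^ j)⁻¹ * Λ * (cϱ * (θ ^ j) ^ 2) = Λ * cϱ * θ ^ j := by field_simp
  rw [hinv]
  -- every slack carries at least one factor `θ^j ≤ 1`
  have h1 : cε * θ ^ j * (cε' * θ ^ j) ≤ cε * cε' * θ ^ j := by
    have : cε * cε' * θ ^ j * θ ^ j ≤ cε * cε' * θ ^ j * 1 :=
      mul_le_mul_of_nonneg_left hθj1 (mul_nonneg (mul_nonneg hcε hcε') hθj.le)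
    nlinarith [this]
  have h2 : cε * θ ^ j * (cδ' * θ ^ j) ≤ cε * cδ' * θ ^ j := by
    have : cε * cδ' * θ ^ j * θ ^ j ≤ cε * cδ' * θ ^ j * 1 :=
      mul_le_mul_of_nonneg_left hθj1 (mul_nonneg (mul_nonneg hcε hcδ') hθj.le)
    nlinarith [this]
  have h3 : Λ * (cϱ * (θ ^ j) ^ 2) ≤ Λ * cϱ * θ ^ j := by
    have : Λ * cϱ * θ ^ j * θ ^ j ≤ Λ * cϱ * θ ^ j * 1 :=
      mul_le_mul_of_nonneg_left hθj1 (mul_nonneg (mul_nonneg hΛ0 hcϱ) hθj.le)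
    nlinarith [this]
  nlinarith [h1, h2, h3, mul_nonneg hΛ0 hθj.le, mul_nonneg hN0 hθj.le, mul_nonneg (mul_nonneg hΛ0 hcε) hθj.le,
    mul_nonneg (mul_nonneg hN0 hcδ') hθj.le, mul_le_mul_of_nonneg_left h1 hΛ0, mul_le_mul_of_nonneg_left h2 hN0]

end Legs

/-! ## §4 The capstone under (STAB-ε′,δ′) + (PROL-ε,δ) + (ROW) + `Λ` + `N` + S2 -/

section Capstone

variable {c : Type*} [Fintype c] [DecidableEq c]
variable {ν : ℕ → Type*} [∀ k, Fintype (ν k)] [∀ k, DecidableEq (ν k)]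
variable {H H₁ H₂ : ∀ k, Matrix (ν k) (ν k) ℝ} {Q Q₁ Q₂ : ∀ k, Matrix c (ν k) ℝ}
variable {Qf : ∀ k, ℝ → ℝ → Matrix (ν k) (ν (k + 1)) ℝ} {P : ∀ k, ℝ → ℝ → Matrix (ν (k + 1)) (ν k) ℝ}
variable {G : ∀ k, ℝ → ℝ → Matrix (ν k) (ν k) ℝ}
variable {ρ s₁ B cε cδ cε' cδ' cϱ Λ N θ : ℝ}

/-- **`effForm_affine₂_step_rate_of_stabGram_of_prolGram_of_row` — (S1) PRODUCED BY THE ROW-DEFECT SQUEEZE** [our proof; PART 29 BY NAME]: real affine two-bond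
towers `(H_k + sH₁ₖ + tH₂ₖ, Q_k + sQ₁ₖ + tQ₂ₖ)` with one-step averagings `Qf_k(s,t)`, prolongations `P_k(s,t)` (NOT assumed averaging-compatible) and symmetric mass
forms `G_k(s,t)` such that at every real `(s,t) ∈ [0,s₁]²`: PSD fine forms, `Q_{k+1} = Q_k·Qf_k`, (STAB-ε′_k,δ′_k) `Qf_kᵀH_kQf_k ≤ (1 + cε′θ^k)H_{k+1} + (cδ′θ^k)G_{k+1}`,
(PROL-ε_k,δ_k) `P_kᵀH_{k+1}P_k ≤ (1 + cεθ^k)H_k + (cδθ^k)G_k`, (ROW_k) `|Q_{k+1}P_kℋ_ke_y − e_y|² ≤ cϱ·(θ^k)²`, the form bound `⟨w,𝒮_kw⟩ ≤ Λ|w|²` and the Gram bound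
`|(ℋ_kᵀG_kℋ_k)_{ab}| ≤ N`; S2: complexified bordered matrices nonsingular with `‖𝒮_k(z)_{ab}‖ ≤ B` on the bidisc (`0 < s₁`, `s₁·cosh 1 < ρ`; `0 ≤ cε, cδ, cε′, cδ′`, `0 < θ`)
⟹ the complexified effective forms have the value rate `((1 + cε + 2cε′ + cϱ)·Λ + (cδ + 2cδ′)·N)·θ^k` on the real square. -/
theorem effForm_affine₂_step_rate_of_stabGram_of_prolGram_of_row (hs₁ : 0 < s₁) (hs₁ρ : s₁ * Real.cosh 1 < ρ)
    (hdet : ∀ k, ∀ z ∈ ball (0 : ℂ) ρ ×ˢ ball (0 : ℂ) ρ,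
      IsUnit (kkt ((H k).map Complex.ofRealHom + z.1 • (H₁ k).map Complex.ofRealHom + z.2 • (H₂ k).map Complex.ofRealHom)
        ((Q k).map Complex.ofRealHom + z.1 • (Q₁ k).map Complex.ofRealHom + z.2 • (Q₂ k).map Complex.ofRealHom)).det)
    (hH : ∀ k (s t : ℝ), 0 ≤ s → s ≤ s₁ → 0 ≤ t → t ≤ s₁ → (H k + s • H₁ k + t • H₂ k).PosSemidef)
    (hcomp : ∀ k (s t : ℝ), 0 ≤ s → s ≤ s₁ → 0 ≤ t → t ≤ s₁ →
      Q (k + 1) + s • Q₁ (k + 1) + t • Q₂ (k + 1) = (Q k + s • Q₁ k + t • Q₂ k) * Qf k s t)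
    (hG : ∀ k (s t : ℝ), (G k s t)ᵀ = G k s t) (hcε : 0 ≤ cε) (hcδ : 0 ≤ cδ) (hcε' : 0 ≤ cε') (hcδ' : 0 ≤ cδ') (hθ : 0 < θ)
    (hstab : ∀ k (s t : ℝ), 0 ≤ s → s ≤ s₁ → 0 ≤ t → t ≤ s₁ →
      ((1 + cε' * θ ^ k) • (H (k + 1) + s • H₁ (k + 1) + t • H₂ (k + 1)) + (cδ' * θ ^ k) • G (k + 1) s t
        - (Qf k s t)ᵀ * (H k + s • H₁ k + t • H₂ k) * Qf k s t).PosSemidef)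
    (hprol : ∀ k (s t : ℝ), 0 ≤ s → s ≤ s₁ → 0 ≤ t → t ≤ s₁ →
      ((1 + cε * θ ^ k) • (H k + s • H₁ k + t • H₂ k) + (cδ * θ ^ k) • G k s t
        - (P k s t)ᵀ * (H (k + 1) + s • H₁ (k + 1) + t • H₂ (k + 1)) * P k s t).PosSemidef)
    (hrow : ∀ k (s t : ℝ), 0 ≤ s → s ≤ s₁ → 0 ≤ t → t ≤ s₁ → ∀ y : c,
      ((Q (k + 1) + s • Q₁ (k + 1) + t • Q₂ (k + 1)) *ᵥ (P k s t *ᵥ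
          (minOp (H k + s • H₁ k + t • H₂ k) (Q k + s • Q₁ k + t • Q₂ k) *ᵥ Pi.single y 1)) - Pi.single y 1) ⬝ᵥ
        ((Q (k + 1) + s • Q₁ (k + 1) + t • Q₂ (k + 1)) *ᵥ (P k s t *ᵥ
          (minOp (H k + s • H₁ k + t • H₂ k) (Q k + s • Q₁ k + t • Q₂ k) *ᵥ Pi.single y 1)) - Pi.single y 1) ≤ cϱ * (θ ^ k) ^ 2)
    (hΛ : ∀ k (s t : ℝ), 0 ≤ s → s ≤ s₁ → 0 ≤ t → t ≤ s₁ → ∀ w : c → ℝ,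
      w ⬝ᵥ (effForm (H k + s • H₁ k + t • H₂ k) (Q k + s • Q₁ k + t • Q₂ k) *ᵥ w) ≤ Λ * (w ⬝ᵥ w))
    (hN : ∀ k (s t : ℝ), 0 ≤ s → s ≤ s₁ → 0 ≤ t → t ≤ s₁ → ∀ a b : c,
      |((minOp (H k + s • H₁ k + t • H₂ k) (Q k + s • Q₁ k + t • Q₂ k))ᵀ * G k s t
          * minOp (H k + s • H₁ k + t • H₂ k) (Q k + s • Q₁ k + t • Q₂ k)) a b| ≤ N)
    (a b : c) :
    ∀ k (s t : ℝ), 0 ≤ s → s ≤ s₁ → 0 ≤ t → t ≤ s₁ →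
      ‖effForm ((H (k + 1)).map Complex.ofRealHom + (s : ℂ) • (H₁ (k + 1)).map Complex.ofRealHom + (t : ℂ) • (H₂ (k + 1)).map Complex.ofRealHom)
            ((Q (k + 1)).map Complex.ofRealHom + (s : ℂ) • (Q₁ (k + 1)).map Complex.ofRealHom + (t : ℂ) • (Q₂ (k + 1)).map Complex.ofRealHom) a b
        - effForm ((H k).map Complex.ofRealHom + (s : ℂ) • (H₁ k).map Complex.ofRealHom + (t : ℂ) • (H₂ k).map Complex.ofRealHom)
            ((Q k).map Complex.ofRealHom + (s : ℂ) • (Q₁ k).map Complex.ofRealHom + (t : ℂ) • (Q₂ k).map Complex.ofRealHom) a b‖ ≤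
        ((1 + cε + 2 * cε' + cϱ) * Λ + (cδ + 2 * cδ') * N) * θ ^ k := by
  intro k s t hs0 hs1 ht0 ht1
  have hs₁' : s₁ ≤ s₁ * Real.cosh 1 := le_mul_of_one_le_right hs₁.le (Real.one_le_cosh 1)
  have hmem : ((s : ℂ), (t : ℂ)) ∈ ball (0 : ℂ) ρ ×ˢ ball (0 : ℂ) ρ := by
    refine ⟨?_, ?_⟩
    · rw [mem_ball_zero_iff, Complex.norm_real, Real.norm_eq_abs, abs_of_nonneg hs0]; linarith
    · rw [mem_ball_zero_iff, Complex.norm_real, Real.norm_eq_abs, abs_of_nonneg ht0]; linarith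
  have hreal : ∀ j, IsUnit (kkt (H j + s • H₁ j + t • H₂ j) (Q j + s • Q₁ j + t • Q₂ j)).det := fun j =>
    isUnit_det_kkt_affine₂_real _ _ _ _ _ _ s t (hdet j ((s : ℂ), (t : ℂ)) hmem)
  have hrate := effForm_entry_step_rate_of_stabGram_of_prolGram_of_row
    (H := fun j => H j + s • H₁ j + t • H₂ j) (Qc := fun j => Q j + s • Q₁ j + t • Q₂ j)
    (Qf := fun j => Qf j s t) (P := fun j => P j s t) (G := fun j => G j s t)
    (fun j => hH j s t hs0 hs1 ht0 ht1) hreal (fun j => hcomp j s t hs0 hs1 ht0 ht1) (fun j => hG j s t)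
    hcε hcδ hcε' hcδ' hθ (fun j => hstab j s t hs0 hs1 ht0 ht1) (fun j => hprol j s t hs0 hs1 ht0 ht1)
    (fun j => hrow j s t hs0 hs1 ht0 ht1) (fun j => hΛ j s t hs0 hs1 ht0 ht1) (fun j => hN j s t hs0 hs1 ht0 ht1) k a b
  rw [effForm_affine₂_ofReal _ _ _ _ _ _ s t (hreal (k + 1)), effForm_affine₂_ofReal _ _ _ _ _ _ s t (hreal k),
    ← Complex.ofReal_sub, Complex.norm_real, Real.norm_eq_abs]
  exact hrate

/-- **`dEffForm_step_rateω_of_stabGram_of_prolGram_of_row` — THE CAPSTONE OF THE ROW-DEFECT SQUEEZE** [our proof; PART 13 + the previous theorem]: under the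
hypotheses of `effForm_affine₂_step_rate_of_stabGram_of_prolGram_of_row` with S2's bound `‖𝒮_k(z)_{ab}‖ ≤ B` on the bidisc, `0 < Λ`, `0 ≤ N`: for every `r ∈ ]0,1]`
and `k`, `‖dEffForm_{k+1} − dEffForm_k‖ ≤ 25·(2B)^r∕(s₁r²)·C^{1−r}·(θ^{1−r})^k`, `C = (1 + cε + 2cε′ + cϱ)·Λ + (cδ + 2cδ′)·N` (complexified letters; first bond
direction) — an1's first B-jet rows from (STAB-ε′,δ′) + (PROL-ε,δ) + (ROW) + `Λ` + `N` + S2; NO value rate assumed, NO averaging-compatibility, NO (CONS). -/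
theorem dEffForm_step_rateω_of_stabGram_of_prolGram_of_row (hs₁ : 0 < s₁) (hs₁ρ : s₁ * Real.cosh 1 < ρ)
    (hdet : ∀ k, ∀ z ∈ ball (0 : ℂ) ρ ×ˢ ball (0 : ℂ) ρ,
      IsUnit (kkt ((H k).map Complex.ofRealHom + z.1 • (H₁ k).map Complex.ofRealHom + z.2 • (H₂ k).map Complex.ofRealHom)
        ((Q k).map Complex.ofRealHom + z.1 • (Q₁ k).map Complex.ofRealHom + z.2 • (Q₂ k).map Complex.ofRealHom)).det)
    (hB : ∀ k, ∀ z ∈ ball (0 : ℂ) ρ ×ˢ ball (0 : ℂ) ρ, ∀ a b : c,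
      ‖effForm ((H k).map Complex.ofRealHom + z.1 • (H₁ k).map Complex.ofRealHom + z.2 • (H₂ k).map Complex.ofRealHom)
        ((Q k).map Complex.ofRealHom + z.1 • (Q₁ k).map Complex.ofRealHom + z.2 • (Q₂ k).map Complex.ofRealHom) a b‖ ≤ B)
    (hH : ∀ k (s t : ℝ), 0 ≤ s → s ≤ s₁ → 0 ≤ t → t ≤ s₁ → (H k + s • H₁ k + t • H₂ k).PosSemidef)
    (hcomp : ∀ k (s t : ℝ), 0 ≤ s → s ≤ s₁ → 0 ≤ t → t ≤ s₁ →
      Q (k + 1) + s • Q₁ (k + 1) + t • Q₂ (k + 1) = (Q k + s • Q₁ k + t • Q₂ k) * Qf k s t)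
    (hG : ∀ k (s t : ℝ), (G k s t)ᵀ = G k s t) (hcε : 0 ≤ cε) (hcδ : 0 ≤ cδ) (hcε' : 0 ≤ cε') (hcδ' : 0 ≤ cδ') (hΛ0 : 0 < Λ) (hN0 : 0 ≤ N)
    (hstab : ∀ k (s t : ℝ), 0 ≤ s → s ≤ s₁ → 0 ≤ t → t ≤ s₁ →
      ((1 + cε' * θ ^ k) • (H (k + 1) + s • H₁ (k + 1) + t • H₂ (k + 1)) + (cδ' * θ ^ k) • G (k + 1) s t
        - (Qf k s t)ᵀ * (H k + s • H₁ k + t • H₂ k) * Qf k s t).PosSemidef)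
    (hprol : ∀ k (s t : ℝ), 0 ≤ s → s ≤ s₁ → 0 ≤ t → t ≤ s₁ →
      ((1 + cε * θ ^ k) • (H k + s • H₁ k + t • H₂ k) + (cδ * θ ^ k) • G k s t
        - (P k s t)ᵀ * (H (k + 1) + s • H₁ (k + 1) + t • H₂ (k + 1)) * P k s t).PosSemidef)
    (hrow : ∀ k (s t : ℝ), 0 ≤ s → s ≤ s₁ → 0 ≤ t → t ≤ s₁ → ∀ y : c,
      ((Q (k + 1) + s • Q₁ (k + 1) + t • Q₂ (k + 1)) *ᵥ (P k s t *ᵥ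
          (minOp (H k + s • H₁ k + t • H₂ k) (Q k + s • Q₁ k + t • Q₂ k) *ᵥ Pi.single y 1)) - Pi.single y 1) ⬝ᵥ
        ((Q (k + 1) + s • Q₁ (k + 1) + t • Q₂ (k + 1)) *ᵥ (P k s t *ᵥ
          (minOp (H k + s • H₁ k + t • H₂ k) (Q k + s • Q₁ k + t • Q₂ k) *ᵥ Pi.single y 1)) - Pi.single y 1) ≤ cϱ * (θ ^ k) ^ 2)
    (hcϱ : 0 ≤ cϱ)
    (hΛ : ∀ k (s t : ℝ), 0 ≤ s → s ≤ s₁ → 0 ≤ t → t ≤ s₁ → ∀ w : c → ℝ,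
      w ⬝ᵥ (effForm (H k + s • H₁ k + t • H₂ k) (Q k + s • Q₁ k + t • Q₂ k) *ᵥ w) ≤ Λ * (w ⬝ᵥ w))
    (hN : ∀ k (s t : ℝ), 0 ≤ s → s ≤ s₁ → 0 ≤ t → t ≤ s₁ → ∀ a b : c,
      |((minOp (H k + s • H₁ k + t • H₂ k) (Q k + s • Q₁ k + t • Q₂ k))ᵀ * G k s t
          * minOp (H k + s • H₁ k + t • H₂ k) (Q k + s • Q₁ k + t • Q₂ k)) a b| ≤ N)
    (hθ : 0 < θ) {r : ℝ} (hr : 0 < r) (hr1 : r ≤ 1) (k : ℕ) (a b : c) :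
    ‖dEffForm ((H (k + 1)).map Complex.ofRealHom) ((Q (k + 1)).map Complex.ofRealHom) ((H₁ (k + 1)).map Complex.ofRealHom)
          ((Q₁ (k + 1)).map Complex.ofRealHom) a b
        - dEffForm ((H k).map Complex.ofRealHom) ((Q k).map Complex.ofRealHom) ((H₁ k).map Complex.ofRealHom)
          ((Q₁ k).map Complex.ofRealHom) a b‖ ≤
      25 * (2 * B) ^ r / (s₁ * r ^ 2) * ((1 + cε + 2 * cε' + cϱ) * Λ + (cδ + 2 * cδ') * N) ^ (1 - r) * (θ ^ (1 - r)) ^ k := by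
  have hc' : 0 < (1 + cε + 2 * cε' + cϱ) * Λ + (cδ + 2 * cδ') * N := by
    have h1 : Λ ≤ (1 + cε + 2 * cε' + cϱ) * Λ := by nlinarith
    have h2 : 0 ≤ (cδ + 2 * cδ') * N := by positivity
    linarith
  exact dEffForm_step_rateω (μ := fun _ => c) (i := fun _ => a) (j := fun _ => b)
    (H := fun k => (H k).map Complex.ofRealHom) (H₁ := fun k => (H₁ k).map Complex.ofRealHom)
    (H₂ := fun k => (H₂ k).map Complex.ofRealHom) (Q := fun k => (Q k).map Complex.ofRealHom)
    (Q₁ := fun k => (Q₁ k).map Complex.ofRealHom) (Q₂ := fun k => (Q₂ k).map Complex.ofRealHom)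
    hs₁ hs₁ρ hdet (fun k z hz => hB k z hz a b)
    (effForm_affine₂_step_rate_of_stabGram_of_prolGram_of_row hs₁ hs₁ρ hdet hH hcomp hG hcε hcδ hcε' hcδ' hθ hstab hprol hrow hΛ hN a b)
    hc' hθ hr hr1 k

end Capstone

end Summit.QuantumFields.BalabanUV.Beta.GAN24.DerivativeRateTransferSqueezeEnd

end
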